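import Summits.AtomisticToContinuum.Crystallization.Theorems.ChargedEnergyGapDualPriceSwap
import HarnessLib

/-!
# RoofRelabel (lens-3 g91, NODE 106) — structure of the roof used by the S2 census cell: relabel-invariance, CONVEXITY, one roof value per hole,
# and the cap at the attributed axis

Fifth cost-side piece of the CELLCERT replay path (after NODES 93/96/100/103/105).  Four facts about the objects of the deciding leaf
`(T¹ᶜ) = StencilChartLawQ 130 (1/60000000) 160 (3/100) (679/1000) (691/1000)` that every census cell (pure box «Level-B» or Farkas «Level-F») uses:

* §106.1 ★ `roofVal_relabel` — the roof of ANY table is invariant under the 48 relabellings of the octahedron (the roof set is literally the same set: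
  relabellings compose, tree `relabel_comp`, and invert, tree `relabel_inv`).
* §106.2 ★★★ `feetHoleCost_eq_roofVal` — the six anchor labellings `anchorLab u` of tree `feetHoleCost` ARE relabellings (`anchorLab_eq_relabel`, `decide`),
  so the six roof values of a hole coincide and `feetHoleCost ϱ τ ρ d w = (τ·2ρ)² · roofVal T75 (vtxW ϱ d w)` — ONE LP per hole, not six
  (`vtxW ϱ d w p = φ_ϱ(d (holeVertex w p))`, the vertex weights in the slot order of `sum_six`); `feetHoleCost_le_of_roofVal_le` is the cell form.
* §106.3 ★★★ `roofVal_T75_convexOn` — THE ROOF IS CONVEX in the weight vector on the non-negative orthant (concatenate two representations: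
  `roofSet_add_mem`; any table with non-negative values: `roofVal_convex_comb`).  Consequence used by NODE 107: on a weight box the roof is bounded by
  its largest CORNER value — the exact cost-side certificate of an S2 cell, with no envelope and no basis bookkeeping.
* §106.4 ★★ `cap_at_chargeDepth` — the attributed axis `hAxis` has the least pole-depth sum (`sum_hAxis_le`, from tree `fc_hKink_hAxis`), hence on a
  depth box the charge depth `chargeDepth ρ d 0` lies in the `t`-interval of SOME axis whose low pole sum does not exceed every high pole sum; a cap
  floor certified on each such `(ρ, t)` box (NODE 99 `capCell_lower`, vacuous axes discharged by arithmetic) bounds `domCapK` at the charge depth.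
-/

noncomputable section
open scoped Classical
open Finset
open Literature.MathematicalPhysics.StatisticalMechanics Literature.Geometry.DiscreteGeometry
open Summit.AtomisticToContinuum.Crystallization.Theses.PricedLinkCensus
open Summit.AtomisticToContinuum.Crystallization.Theorems.ChargedEnergyGapNegative

namespace Summit.AtomisticToContinuum.Crystallization.Theorems.ChargedEnergyGapChartDial

/-! ## §106.1 Relabel-invariance of the roof -/

/-- Every relabelling has a two-sided inverse relabelling. -/
theorem relabel_inv_two (g₀ : Fin 6) (σ₀ : Fin 8) :
    ∃ (g₁ : Fin 6) (σ₁ : Fin 8), (∀ p, relabel g₁ σ₁ (relabel g₀ σ₀ p) = p) ∧ ∀ p, relabel g₀ σ₀ (relabel g₁ σ₁ p) = p := by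
  obtain ⟨g₁, σ₁, h⟩ := relabel_inv g₀ σ₀
  refine ⟨g₁, σ₁, h, fun p => ?_⟩
  obtain ⟨q, rfl⟩ := (relabel_bijective g₀ σ₀).2 p
  rw [h q]

/-- A representation of `Wv` relabelled by `(g₀, σ₀)` is a representation of `Wv ∘ relabel g₀ σ₀` (relabellings compose). -/
theorem roofSet_subset_relabel (T : List ((Fin 3 × Bool → ℝ) × ℝ)) (Wv : Fin 3 × Bool → ℝ) (g₀ : Fin 6) (σ₀ : Fin 8) :
    roofSet T Wv ⊆ roofSet T (fun p => Wv (relabel g₀ σ₀ p)) := by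
  rintro t ⟨n, w, g, σ, lam, hw, hl, hW, rfl⟩
  choose g' σ' hc using fun i => relabel_comp (g i) (σ i) g₀ σ₀
  refine ⟨n, w, g', σ', lam, hw, hl, fun p => ?_, rfl⟩
  show Wv (relabel g₀ σ₀ p) = _
  rw [hW]; exact Finset.sum_congr rfl fun i _ => by rw [hc i]

/-- The roof set is invariant under relabelling of the weight vector. -/
theorem roofSet_relabel (T : List ((Fin 3 × Bool → ℝ) × ℝ)) (Wv : Fin 3 × Bool → ℝ) (g₀ : Fin 6) (σ₀ : Fin 8) :
    roofSet T (fun p => Wv (relabel g₀ σ₀ p)) = roofSet T Wv := by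
  refine Set.Subset.antisymm ?_ (roofSet_subset_relabel T Wv g₀ σ₀)
  obtain ⟨g₁, σ₁, -, h₂⟩ := relabel_inv_two g₀ σ₀
  have e : (fun p => Wv (relabel g₀ σ₀ (relabel g₁ σ₁ p))) = Wv := funext fun p => by rw [h₂ p]
  simpa [e] using roofSet_subset_relabel T (fun p => Wv (relabel g₀ σ₀ p)) g₁ σ₁

/-- ★ THE ROOF IS RELABEL-INVARIANT (any table). -/
theorem roofVal_relabel (T : List ((Fin 3 × Bool → ℝ) × ℝ)) (Wv : Fin 3 × Bool → ℝ) (g₀ : Fin 6) (σ₀ : Fin 8) :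
    roofVal T (fun p => Wv (relabel g₀ σ₀ p)) = roofVal T Wv := by
  unfold roofVal; rw [roofSet_relabel]

/-! ## §106.2 The six anchor labellings are relabellings: one roof value per hole -/

set_option maxHeartbeats 4000000 in
/-- Each anchor labelling `anchorLab u` (tree `feetHoleCost`) is one of the 48 relabellings. [finite check, `decide`] -/
theorem anchorLab_eq_relabel : ∀ u : Fin 3 × Bool, ∃ (g : Fin 6) (σ : Fin 8), ∀ p, anchorLab u p = relabel g σ p := by decide

/-- The VERTEX WEIGHTS of the hole `w` in slot order: `vtxW ϱ d w p = φ_ϱ(d (holeVertex w p))`. -/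
def vtxW (ϱ : ℝ) (d : (Fin 3 → ℤ) → ℝ) (w : Fin 3 → ℤ) (p : Fin 3 × Bool) : ℝ := depthProfile ϱ (d (holeVertex w p))

/-- `0 ≤ vtxW`. -/
theorem vtxW_nonneg (ϱ : ℝ) (d : (Fin 3 → ℤ) → ℝ) (w : Fin 3 → ℤ) (p : Fin 3 × Bool) : 0 ≤ vtxW ϱ d w p := depthProfile_nonneg _ _

/-- The roof value seen from anchor `u` is the roof value of the hole. -/
theorem roofVal_anchorLab (ϱ : ℝ) (d : (Fin 3 → ℤ) → ℝ) (w : Fin 3 → ℤ) (u : Fin 3 × Bool) :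
    roofVal T75 (fun p => depthProfile ϱ (d (holeVertex w (anchorLab u p)))) = roofVal T75 (vtxW ϱ d w) := by
  obtain ⟨g, σ, h⟩ := anchorLab_eq_relabel u
  have e : (fun p => depthProfile ϱ (d (holeVertex w (anchorLab u p)))) = fun p => vtxW ϱ d w (relabel g σ p) := funext fun p => by rw [h p]; rfl
  rw [e, roofVal_relabel]

/-- ★★★ ONE LP PER HOLE: `feetHoleCost ϱ τ ρ d w = (τ·2ρ)² · roofVal T75 (vtxW ϱ d w)`. -/
theorem feetHoleCost_eq_roofVal (ϱ τ ρ : ℝ) (d : (Fin 3 → ℤ) → ℝ) (w : Fin 3 → ℤ) :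
    feetHoleCost ϱ τ ρ d w = (τ * (2 * ρ)) ^ 2 * roofVal T75 (vtxW ϱ d w) := by
  unfold feetHoleCost
  have h : ∀ u : Fin 3 × Bool, (1 / 6 : ℝ) * max 0 ((τ * (2 * ρ)) ^ 2 * roofVal T75 (fun p => depthProfile ϱ (d (holeVertex w (anchorLab u p)))))
      = (1 / 6) * ((τ * (2 * ρ)) ^ 2 * roofVal T75 (vtxW ϱ d w)) := fun u => by
    rw [roofVal_anchorLab, max_eq_right (mul_nonneg (sq_nonneg _) (roofVal_T75_nonneg _))]
  rw [Finset.sum_congr rfl fun u _ => h u, Finset.sum_const, Finset.card_univ, Fintype.card_prod, Fintype.card_fin, Fintype.card_bool, nsmul_eq_mul]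
  push_cast; ring

/-- ★ Cell form of the cost: a roof majorant `R` and `ρ ≤ ρ₁` give `feetHoleCost ≤ (τ·2ρ₁)²·R`. -/
theorem feetHoleCost_le_of_roofVal_le {ϱ τ ρ ρ₁ R : ℝ} {d : (Fin 3 → ℤ) → ℝ} {w : Fin 3 → ℤ} (hτ : 0 ≤ τ) (hρ : 0 ≤ ρ) (hρ₁ : ρ ≤ ρ₁)
    (hR : roofVal T75 (vtxW ϱ d w) ≤ R) : feetHoleCost ϱ τ ρ d w ≤ (τ * (2 * ρ₁)) ^ 2 * R := by
  rw [feetHoleCost_eq_roofVal]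
  have h0 : 0 ≤ roofVal T75 (vtxW ϱ d w) := roofVal_T75_nonneg _
  have h1 : (τ * (2 * ρ)) ^ 2 ≤ (τ * (2 * ρ₁)) ^ 2 := by
    apply pow_le_pow_left₀ (by positivity); nlinarith
  calc (τ * (2 * ρ)) ^ 2 * roofVal T75 (vtxW ϱ d w) ≤ (τ * (2 * ρ₁)) ^ 2 * roofVal T75 (vtxW ϱ d w) := mul_le_mul_of_nonneg_right h1 h0
    _ ≤ (τ * (2 * ρ₁)) ^ 2 * R := mul_le_mul_of_nonneg_left hR (by positivity)

/-! ## §106.3 The roof is convex in the weights -/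

/-- Concatenation of representations: a non-negative combination of members of two roof sets lies in the roof set of the combined weights. -/
theorem roofSet_add_mem {T : List ((Fin 3 × Bool → ℝ) × ℝ)} {W₁ W₂ : Fin 3 × Bool → ℝ} {t₁ t₂ a b : ℝ} (ha : 0 ≤ a) (hb : 0 ≤ b)
    (h₁ : t₁ ∈ roofSet T W₁) (h₂ : t₂ ∈ roofSet T W₂) : a * t₁ + b * t₂ ∈ roofSet T (fun p => a * W₁ p + b * W₂ p) := by
  obtain ⟨n₁, w₁, g₁, σ₁, l₁, hw₁, hl₁, hW₁, rfl⟩ := h₁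
  obtain ⟨n₂, w₂, g₂, σ₂, l₂, hw₂, hl₂, hW₂, rfl⟩ := h₂
  refine ⟨n₁ + n₂, Fin.append w₁ w₂, Fin.append g₁ g₂, Fin.append σ₁ σ₂, Fin.append (fun i => a * l₁ i) (fun i => b * l₂ i), ?_, ?_, ?_, ?_⟩
  · intro i; induction i using Fin.addCases <;> simp [hw₁, hw₂]
  · intro i; induction i using Fin.addCases
    · simpa using mul_nonneg ha (hl₁ _)
    · simpa using mul_nonneg hb (hl₂ _)
  · intro p
    rw [Fin.sum_univ_add]; simp only [Fin.append_left, Fin.append_right]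
    rw [hW₁ p, hW₂ p, Finset.mul_sum, Finset.mul_sum]
    exact congrArg₂ (· + ·) (Finset.sum_congr rfl fun i _ => by ring) (Finset.sum_congr rfl fun i _ => by ring)
  · rw [Fin.sum_univ_add]; simp only [Fin.append_left, Fin.append_right]
    rw [Finset.mul_sum, Finset.mul_sum]
    exact congrArg₂ (· + ·) (Finset.sum_congr rfl fun i _ => by ring) (Finset.sum_congr rfl fun i _ => by ring)

/-- ★★ The roof of a table with non-negative values is CONVEX along segments between representable weight vectors. -/
theorem roofVal_convex_comb {T : List ((Fin 3 × Bool → ℝ) × ℝ)} (hT : ∀ e ∈ T, 0 ≤ e.2) {W₁ W₂ : Fin 3 × Bool → ℝ}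
    (h₁ : (roofSet T W₁).Nonempty) (h₂ : (roofSet T W₂).Nonempty) {a b : ℝ} (ha : 0 ≤ a) (hb : 0 ≤ b) :
    roofVal T (fun p => a * W₁ p + b * W₂ p) ≤ a * roofVal T W₁ + b * roofVal T W₂ := by
  refine le_of_forall_pos_lt_add fun ε hε => ?_
  have hab : 0 < a + b + 1 := by linarith
  have hε' : 0 < ε / (a + b + 1) := div_pos hε hab
  obtain ⟨t₁, ht₁, hlt₁⟩ := Real.lt_sInf_add_pos h₁ hε'
  obtain ⟨t₂, ht₂, hlt₂⟩ := Real.lt_sInf_add_pos h₂ hε'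
  have k₁ : t₁ < roofVal T W₁ + ε / (a + b + 1) := hlt₁
  have k₂ : t₂ < roofVal T W₂ + ε / (a + b + 1) := hlt₂
  have hle : roofVal T (fun p => a * W₁ p + b * W₂ p) ≤ a * t₁ + b * t₂ := roofVal_le_of_mem hT (roofSet_add_mem ha hb ht₁ ht₂)
  have e : (a + b) * (ε / (a + b + 1)) = ε - ε / (a + b + 1) := by field_simp; ring
  nlinarith [mul_le_mul_of_nonneg_left k₁.le ha, mul_le_mul_of_nonneg_left k₂.le hb]

/-- ★★★ THE ROOF OF `T75` IS CONVEX on the non-negative orthant (where every weight vector is representable, tree `roofSet_T75_nonempty`). -/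
theorem roofVal_T75_convexOn : ConvexOn ℝ {W : Fin 3 × Bool → ℝ | ∀ q, 0 ≤ W q} (roofVal T75) := by
  refine ⟨?_, ?_⟩
  · intro W₁ h₁ W₂ h₂ a b ha hb _
    simp only [Set.mem_setOf_eq] at h₁ h₂ ⊢
    intro q
    simp only [Pi.add_apply, Pi.smul_apply, smul_eq_mul]
    exact add_nonneg (mul_nonneg ha (h₁ q)) (mul_nonneg hb (h₂ q))
  · intro W₁ h₁ W₂ h₂ a b ha hb _
    simp only [Set.mem_setOf_eq] at h₁ h₂
    have e : a • W₁ + b • W₂ = fun p => a * W₁ p + b * W₂ p := funext fun p => by simp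
    rw [e, smul_eq_mul, smul_eq_mul]
    exact roofVal_convex_comb T75_values_nonneg (roofSet_T75_nonempty W₁ h₁) (roofSet_T75_nonempty W₂ h₂) ha hb

/-- ★★★ CORNER MAJORANT: on a weight box `L ≤ W ≤ U` with `0 ≤ L` the roof of `T75` is bounded by its largest corner value
(the box is the convex hull of its `64` corners; maximum principle for convex functions). -/
theorem roofVal_T75_le_of_corners {L U : Fin 3 × Bool → ℝ} (hL : ∀ q, 0 ≤ L q) (hLU : ∀ q, L q ≤ U q) {R : ℝ}
    (hc : ∀ b : Fin 3 × Bool → Bool, roofVal T75 (fun q => if b q then U q else L q) ≤ R)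
    (W : Fin 3 × Bool → ℝ) (hW : ∀ q, L q ≤ W q ∧ W q ≤ U q) : roofVal T75 W ≤ R := by
  set t : Set (Fin 3 × Bool → ℝ) := Set.univ.pi fun q => {L q, U q} with ht
  have hts : t ⊆ {W : Fin 3 × Bool → ℝ | ∀ q, 0 ≤ W q} := by
    intro v hv q
    have hq : v q ∈ ({L q, U q} : Set ℝ) := hv q (Set.mem_univ q)
    rcases hq with h | h
    · rw [h]; exact hL q
    · rw [Set.mem_singleton_iff.1 h]; exact (hL q).trans (hLU q)
  have hx : W ∈ convexHull ℝ t := by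
    rw [ht, convexHull_pi]
    intro q _
    show W q ∈ convexHull ℝ ({L q, U q} : Set ℝ)
    rw [convexHull_pair, segment_eq_Icc (hLU q)]
    exact ⟨(hW q).1, (hW q).2⟩
  obtain ⟨v, hv, hle⟩ := roofVal_T75_convexOn.exists_ge_of_mem_convexHull hts hx
  let b : Fin 3 × Bool → Bool := fun q => decide (v q = U q)
  have hvb : v = fun q => if b q then U q else L q := by
    funext q
    have hq : v q ∈ ({L q, U q} : Set ℝ) := hv q (Set.mem_univ q)
    by_cases h : v q = U q
    · simp [b, h]
    · have hl : v q = L q := by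
        rcases hq with h' | h'
        · exact h'
        · exact absurd (Set.mem_singleton_iff.1 h') h
      have hb : b q = false := by simp [b, h]
      simp [hb, hl]
  exact hle.trans (hvb ▸ hc b)

/-! ## §106.4 The attributed axis has the least pole sum: the cap at the charge depth from per-axis cap cells -/

/-- The attributed axis `hAxis` has the least pole-depth sum among the three axes (`ρ > 0`). -/
theorem sum_hAxis_le {ρ : ℝ} (hρ : 0 < ρ) (d : (Fin 3 → ℤ) → ℝ) (w : Fin 3 → ℤ) (b : Fin 3) :
    d (w + axisZ (hAxis ρ d w)) + d (w - axisZ (hAxis ρ d w)) ≤ d (w + axisZ b) + d (w - axisZ b) := by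
  have h : hKink ρ d w b ≤ hKink ρ d w (hAxis ρ d w) := by
    rw [fc_hKink_hAxis]; exact Finset.le_sup' (hKink ρ d w) (Finset.mem_univ b)
  unfold hKink at h
  rw [div_le_div_iff_of_pos_right hρ] at h
  linarith

/-- The charge depth in terms of the two poles of the attributed axis. -/
theorem chargeDepth_eq_holeVertex (ρ : ℝ) (d : (Fin 3 → ℤ) → ℝ) (w : Fin 3 → ℤ) :
    chargeDepth ρ d w = (d (holeVertex w (hAxis ρ d w, true)) + d (holeVertex w (hAxis ρ d w, false))) / 2 + ρ := by
  rw [fc_holeVertex_true, fc_holeVertex_false]; rfl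

/-- ★★ CAP AT THE CHARGE DEPTH from per-axis cap cells.  For each axis `a` whose low pole sum does not exceed every high pole sum, a cap floor on the
box `ρ ∈ [ρ₀, ρ₁]`, `t ∈ [(lo(a,T)+lo(a,F))/2 + ρ₀, (hi(a,T)+hi(a,F))/2 + ρ₁]`; the other axes are vacuous.  Then the floor holds at `chargeDepth ρ d 0`
for every depth function in the box `lo ≤ d ∘ holeVertex 0 ≤ hi`. -/
theorem cap_at_chargeDepth {ρ ρ₀ ρ₁ u capLB ϱ τ : ℝ} {lo hi : Fin 3 × Bool → ℝ} (hρ : 0 < ρ) (hρ₀ : ρ₀ ≤ ρ) (hρ₁ : ρ ≤ ρ₁)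
    (hcap : ∀ a : Fin 3, (∀ b : Fin 3, lo (a, true) + lo (a, false) ≤ hi (b, true) + hi (b, false)) →
      ∀ ρ' t : ℝ, ρ₀ ≤ ρ' → ρ' ≤ ρ₁ → (lo (a, true) + lo (a, false)) / 2 + ρ₀ ≤ t → t ≤ (hi (a, true) + hi (a, false)) / 2 + ρ₁ →
        capLB * u ≤ domCapK u ϱ τ ρ' t)
    (d : (Fin 3 → ℤ) → ℝ) (hd : ∀ q, lo q ≤ d (holeVertex 0 q) ∧ d (holeVertex 0 q) ≤ hi q) :
    capLB * u ≤ domCapK u ϱ τ ρ (chargeDepth ρ d 0) := by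
  set a := hAxis ρ d 0 with ha
  have hmin : ∀ b : Fin 3, lo (a, true) + lo (a, false) ≤ hi (b, true) + hi (b, false) := fun b => by
    have h := sum_hAxis_le hρ d 0 b
    rw [← fc_holeVertex_true, ← fc_holeVertex_false, ← fc_holeVertex_true 0 b, ← fc_holeVertex_false 0 b] at h
    linarith [(hd (a, true)).1, (hd (a, false)).1, (hd (b, true)).2, (hd (b, false)).2]
  rw [chargeDepth_eq_holeVertex]
  refine hcap a hmin ρ _ hρ₀ hρ₁ ?_ ?_
  · linarith [(hd (a, true)).1, (hd (a, false)).1]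
  · linarith [(hd (a, true)).2, (hd (a, false)).2]

end Summit.AtomisticToContinuum.Crystallization.Theorems.ChargedEnergyGapChartDial
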